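import Literature.Geometry.Riemannian.SurgicalRicciFlowTopology
import HarnessLib

/-!
# `IsUnionOfPieces` (Chen–Zhu 2006, Thm. 1.1 (iv)) is a predicate on the manifold: connected
# case, an example, and a counterexample to its universal closure

`Literature/Geometry/Riemannian/SurgicalRicciFlow.lean` renders clause (iv) of Chen–Zhu's
Theorem 1.1 (J. Differential Geom. 74 (2006); arXiv:math/0504478, p. 3: "for `k = m`, `M⁴_m` is
diffeomorphic to the disjoint union of a finite number of `S⁴`, or `ℝℙ⁴`, or `S³ × S¹`, or
`S³ ×~ S¹`, or `ℝℙ⁴ # ℝℙ⁴`") as the *predicate* `IsUnionOfPieces M` on a charted space `M` on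
`ℝ⁴` (it is declared under `variable (M) in`, so its type is
`∀ (M : Type) [TopologicalSpace M] [ChartedSpace (EuclideanSpace ℝ (Fin 4)) M], Prop`): `M` has
finitely many connected components and the component of every point is (the carrier of) an
open submanifold lying in the closure `IsConnectedSumOf 4 IsHamiltonPICPiece` of Hamilton's
pieces under connected sums. In the source, (iv) is a property *of the terminal manifold
`M_m` produced by the flow with surgery*, i.e. a conjunct inside the existential statement of
Thm. 1.1; accordingly the tree consumes the predicate inside `ChenZhuResolvableIn 0 M g₀`,
and the named fact carrying Theorem 1.1 is `chenZhu_ricciFlowWithSurgery`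
(`∃ m, ChenZhuResolvableIn m M g₀`). There is therefore no closed proposition
"`IsUnionOfPieces`" to discharge by a `theorem IsUnionOfPieces_holds`, and the universal
closure of the predicate — even over Hausdorff, second countable `C^∞` 4-manifolds — is false.
This file records exactly that, with proofs:

* `IsUnionOfPieces.finite_componentsOf`, `not_isUnionOfPieces_of_infinite_componentsOf` — the
  predicate bounds the number of components ("a *finite* number of …");
* `IsUnionOfPieces.of_isConnectedSumOf`, `isUnionOfPieces_iff_isConnectedSumOf` — for a
  *connected* `C^∞` manifold, `IsUnionOfPieces M ↔ IsConnectedSumOf 4 IsHamiltonPICPiece M`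
  (the forward direction is `IsUnionOfPieces.isConnectedSumOf` of
  `SurgicalRicciFlowTopology.lean`; conversely the unique component is `univ`, the carrier of
  the open submanifold `⊤ ≅ M`, and the closure is diffeomorphism invariant);
* `isUnionOfPieces_sphere` — the round `𝕊⁴` (the first of Hamilton's pieces) satisfies the
  predicate (non-vacuity);
* `exists_opens_infinite_componentsOf`, `exists_opens_not_isUnionOfPieces` — the open
  submanifold `{x ∈ ℝ⁴ | x₀ ∉ ℤ}` of `ℝ⁴` (the disjoint union of the open slabs `k < x₀ < k + 1`,
  `k ∈ ℤ`) has infinitely many components — the points `(k + ½) e₀`, `k ∈ ℤ`, lie in pairwise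
  distinct components, by the intermediate value theorem for the coordinate `x₀` on a connected
  set avoiding the hyperplanes `x₀ ∈ ℤ` — hence is *not* a finite union of pieces;
* `not_forall_isUnionOfPieces` — so `∀ M, IsUnionOfPieces M` fails already among Hausdorff,
  second countable, smooth 4-manifolds: clause (iv) is dischargeable only as part of
  `chenZhu_ricciFlowWithSurgery`, never on its own.

## References

* B.-L. Chen, X.-P. Zhu, *Ricci flow with surgery on four-manifolds with positive isotropic
  curvature*, J. Differential Geom. 74 (2006) 177–264, arXiv:math/0504478: Thm. 1.1 (iv) (p. 3).
  [ChenZhu2006]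
-/

noncomputable section

open Set Function TopologicalSpace
open scoped Manifold ContDiff Topology

namespace Literature.Geometry.Riemannian

open Literature.Topology.FourManifolds

variable {M : Type} [TopologicalSpace M] [ChartedSpace (EuclideanSpace ℝ (Fin 4)) M]

/-! ### The predicate bounds the number of components -/

/-- A finite union of pieces has finitely many connected components (the first clause of
`IsUnionOfPieces`: "the disjoint union of a *finite* number of …", Chen–Zhu 2006,
Thm. 1.1 (iv)). [cite: ChenZhu2006, Thm. 1.1 (iv) (p. 3)] -/
theorem IsUnionOfPieces.finite_componentsOf (h : IsUnionOfPieces M) :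
    (componentsOf (univ : Set M)).Finite :=
  h.1

/-- Contrapositive: a charted space on `ℝ⁴` with infinitely many connected components is not a
finite union of pieces. [cite: ChenZhu2006, Thm. 1.1 (iv) (p. 3)] -/
theorem not_isUnionOfPieces_of_infinite_componentsOf
    (h : (componentsOf (univ : Set M)).Infinite) : ¬ IsUnionOfPieces M :=
  fun h' ↦ h h'.1

/-! ### Connected manifolds: the predicate is membership in Hamilton's class -/

omit [ChartedSpace (EuclideanSpace ℝ (Fin 4)) M] in
/-- In a preconnected space the set of components of `univ` is contained in `{univ}`, hence is
finite. [folklore] -/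
theorem finite_componentsOf_univ_of_preconnectedSpace [PreconnectedSpace M] :
    (componentsOf (univ : Set M)).Finite := by
  refine (Set.finite_singleton (univ : Set M)).subset ?_
  rintro _ ⟨x, -, rfl⟩
  show connectedComponentIn univ x ∈ ({univ} : Set (Set M))
  rw [mem_singleton_iff, connectedComponentIn_univ, PreconnectedSpace.connectedComponent_eq_univ]

/-- **Converse of `IsUnionOfPieces.isConnectedSumOf`.** A connected `C^∞` 4-manifold in the
closure of Hamilton's pieces under connected sums is a finite union of pieces: its only
component is `univ`, the carrier of the open submanifold `⊤`, which is diffeomorphic to `M`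
(`nonempty_diffeomorph_opens_of_coe_eq_univ`), and the closure is diffeomorphism invariant
(`isConnectedSumOf_isHamiltonPICPiece_of_diffeomorph`). [cite: ChenZhu2006, Thm. 1.1 (iv) (p. 3)] -/
theorem IsUnionOfPieces.of_isConnectedSumOf [IsManifold (𝓡 4) ∞ M] [ConnectedSpace M]
    (h : IsConnectedSumOf 4 IsHamiltonPICPiece M) : IsUnionOfPieces M := by
  refine ⟨finite_componentsOf_univ_of_preconnectedSpace, fun x ↦ ⟨⊤, ?_, ?_⟩⟩
  · rw [PreconnectedSpace.connectedComponent_eq_univ]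
    rfl
  · obtain ⟨e⟩ := nonempty_diffeomorph_opens_of_coe_eq_univ (I := 𝓡 4) (⊤ : Opens M) rfl
    exact isConnectedSumOf_isHamiltonPICPiece_of_diffeomorph h e

/-- For a connected `C^∞` 4-manifold, "finite union of pieces" in the sense of Thm. 1.1 (iv) is
exactly membership in the closure of Hamilton's pieces `S⁴`, `ℝℙ⁴`, `S³ × S¹`, `S³ ×~ S¹` under
connected sums. [cite: ChenZhu2006, Thm. 1.1 (iv) (p. 3)] -/
theorem isUnionOfPieces_iff_isConnectedSumOf [IsManifold (𝓡 4) ∞ M] [ConnectedSpace M] :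
    IsUnionOfPieces M ↔ IsConnectedSumOf 4 IsHamiltonPICPiece M :=
  ⟨IsUnionOfPieces.isConnectedSumOf, IsUnionOfPieces.of_isConnectedSumOf⟩

/-- **Non-vacuity**: the round sphere `𝕊⁴`, the first of Hamilton's pieces, is a finite union of
pieces (`𝕊⁴ ⊆ ℝ⁵` is connected, Mathlib `isConnected_sphere`).
[cite: ChenZhu2006, Thm. 1.1 (iv) (p. 3)] -/
theorem isUnionOfPieces_sphere :
    IsUnionOfPieces (Metric.sphere (0 : EuclideanSpace ℝ (Fin 5)) 1) := by
  haveI : ConnectedSpace (Metric.sphere (0 : EuclideanSpace ℝ (Fin 5)) 1) := by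
    refine isConnected_iff_connectedSpace.mp (isConnected_sphere ?_ 0 zero_le_one)
    rw [← Module.finrank_eq_rank, finrank_euclideanSpace_fin]
    norm_num
  exact IsUnionOfPieces.of_isConnectedSumOf (.piece isHamiltonPICPiece_sphere)

/-! ### An open submanifold of `ℝ⁴` with infinitely many components -/

/-- **An open subset of `ℝ⁴` with infinitely many components.** The complement
`U = {x | x₀ ∉ ℤ}` of the hyperplanes `x₀ ∈ ℤ` (open: `ℤ ⊆ ℝ` is closed and `x ↦ x₀` is
continuous), with Mathlib's open-submanifold structure, has infinitely many connected
components: for integers `j < k` the points `(j + ½) e₀`, `(k + ½) e₀ ∈ U` lie in different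
components, since on a connected subset of `U` containing both the continuous coordinate `x₀`
would take the intermediate value `j + 1 ∈ ℤ` (intermediate value theorem on preconnected
sets), which is excluded on `U`; so `k ↦ (component of (k + ½) e₀)` is injective on `ℤ`.
[folklore] -/
theorem exists_opens_infinite_componentsOf :
    ∃ U : Opens (EuclideanSpace ℝ (Fin 4)), (componentsOf (univ : Set U)).Infinite := by
  have hcont : Continuous fun x : EuclideanSpace ℝ (Fin 4) ↦ x 0 := PiLp.continuous_apply 2 _ 0
  let U : Opens (EuclideanSpace ℝ (Fin 4)) := ⟨{x | x 0 ∉ range ((↑) : ℤ → ℝ)},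
    (Int.isClosedEmbedding_coe_real.isClosed_range.isOpen_compl).preimage hcont⟩
  refine ⟨U, ?_⟩
  -- the points `(k + 1/2) e₀`, `k ∈ ℤ`, lie in `U`
  have hmem : ∀ k : ℤ, EuclideanSpace.single (0 : Fin 4) ((k : ℝ) + 1 / 2) ∈ U := by
    intro k
    show (EuclideanSpace.single (0 : Fin 4) ((k : ℝ) + 1 / 2)) 0 ∉ range ((↑) : ℤ → ℝ)
    rintro ⟨m, hm⟩
    simp only [PiLp.single_apply, if_true] at hm
    have h2 : (2 * m : ℝ) = 2 * k + 1 := by linarith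
    have h3 : 2 * m = 2 * k + 1 := by exact_mod_cast h2
    omega
  obtain ⟨q, hq0⟩ : ∃ q : ℤ → U, ∀ k, (q k : EuclideanSpace ℝ (Fin 4)) 0 = k + 1 / 2 :=
    ⟨fun k ↦ ⟨_, hmem k⟩, fun k ↦ by simp⟩
  -- the coordinate `x₀` is continuous on `U`
  have hf : Continuous fun x : U ↦ (x : EuclideanSpace ℝ (Fin 4)) 0 :=
    hcont.comp continuous_subtype_val
  -- distinct integers give distinct components
  have hlt : ∀ j k : ℤ, j < k → connectedComponent (q j) ≠ connectedComponent (q k) := by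
    intro j k hjk heq
    have hk : q k ∈ connectedComponent (q j) := heq ▸ mem_connectedComponent
    have hIcc := isPreconnected_connectedComponent.intermediate_value
      (mem_connectedComponent (x := q j)) hk hf.continuousOn
    have hmid : ((j + 1 : ℤ) : ℝ) ∈
        Icc ((q j : EuclideanSpace ℝ (Fin 4)) 0) ((q k : EuclideanSpace ℝ (Fin 4)) 0) := by
      rw [hq0, hq0]
      have hjk' : (j : ℝ) + 1 ≤ k := by exact_mod_cast Int.add_one_le_iff.mpr hjk
      push_cast
      constructor <;> linarith
    obtain ⟨x, -, hx⟩ := hIcc hmid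
    have hxU : (x : EuclideanSpace ℝ (Fin 4)) 0 ∉ range ((↑) : ℤ → ℝ) := x.2
    exact hxU ⟨j + 1, hx.symm⟩
  have hinj : Injective fun k ↦ connectedComponent (q k) := by
    intro j k h
    by_contra hne
    rcases lt_or_gt_of_ne hne with hjk | hkj
    · exact hlt j k hjk h
    · exact hlt k j hkj h.symm
  refine (infinite_range_of_injective hinj).mono ?_
  rintro _ ⟨k, rfl⟩
  simpa only [connectedComponentIn_univ] using
    connectedComponentIn_mem_componentsOf (mem_univ (q k))

/-- **There is an open submanifold of `ℝ⁴` which is not a finite union of pieces** (it has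
infinitely many components). [folklore] -/
theorem exists_opens_not_isUnionOfPieces :
    ∃ U : Opens (EuclideanSpace ℝ (Fin 4)), ¬ IsUnionOfPieces U := by
  obtain ⟨U, hU⟩ := exists_opens_infinite_componentsOf
  exact ⟨U, not_isUnionOfPieces_of_infinite_componentsOf hU⟩

/-- **The universal closure of `IsUnionOfPieces` is false**, already among Hausdorff, second
countable `C^∞` 4-manifolds (an open submanifold of `ℝ⁴` with infinitely many components is
such a manifold): the predicate rendering Chen–Zhu 2006, Thm. 1.1 (iv) is a genuine constraint on
`M`, asserted by the theorem only for the terminal manifold `M_m` of the flow with surgery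
(`ChenZhuResolvableIn 0`, inside the named fact `chenZhu_ricciFlowWithSurgery`); no
`IsUnionOfPieces_holds` can exist. [cite: ChenZhu2006, Thm. 1.1 (iv) (p. 3)] -/
theorem not_forall_isUnionOfPieces :
    ¬ ∀ (M : Type) [TopologicalSpace M] [T2Space M] [SecondCountableTopology M]
      [ChartedSpace (EuclideanSpace ℝ (Fin 4)) M] [IsManifold (𝓡 4) ∞ M], IsUnionOfPieces M := by
  intro h
  obtain ⟨U, hU⟩ := exists_opens_not_isUnionOfPieces
  exact hU (h U)

end Literature.Geometry.Riemannian

end
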